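import Literature.AlgebraicGeometry.HodgeTheory.UnitaryReflectionPairInfinite
import Literature.AlgebraicGeometry.HodgeTheory.GlZariskiClosureGroup
import Literature.AlgebraicGeometry.HodgeTheory.ZariskiClosureRealPoints
import HarnessLib

/-!
# Commutators of unitary transformations lie in the real Zariski closure of a unitary reflection group
# of prime order `p ≥ 7` (Carlson–Toledo 1999 §7 Theorem `udensitytheo`, with the centre stripped:
# `[U(h), U(h)] ⊆ Γ^Zar(ℝ)`; Borel I.2.4)

Family `hodge`, layer `Literature/AlgebraicGeometry/HodgeTheory`. THEOREMS only. Consumer corollary of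
littype's `UnitaryReflectionGroupZariskiDense` / `UnitaryReflectionPairInfinite` (the named fact
`carlsonToledo1999_unitaryReflection_zariskiDense`: "`PΓ` Zariski-dense in `PU(p,q)`", rendered as
`U(W,h) ⊆ (Γ·U(1))^Zar(ℝ)`, and its prime-order form `….mem_glZariskiClosure_of_prime_order` with the finite
branch excluded) and of `GlZariskiClosureGroup` (`commutator_mem_glZariskiClosure`: the two-step commutator
argument on `K`-points, Borel I.2.4). Written by the prover seat `hodge-nonav-prover-Ax` (cell `hodge-nonav`)
for crux K1 `VeryGeneralDeckCommutatorsInHg` of `Summits/HodgeConjecture/HodgeConjecture/Theses/CyclicUnitaryPowers.lean`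
— both registered lanes of skeleton v7 need the per-eigenspace density WITHOUT the central `U(1)`: lane A
(B2, STUB-PLAN-B2 Line R step R3/R5) and lane D (the André exit, statement D «unitary commutators ∈ Mon»).

What is proved: `exists_eq_mul_of_mem_realPointsWithUnitScalars` (`Γ·U(1) = {γ z}` elementwise: the unit
scalars commute with the real points of complex-linear maps), and
**`commutator_restrictScalars_mem_glZariskiClosure_of_prime_order`**: under the hypotheses of Theorem
`udensitytheo` with `λ` of prime order `p ≥ 7` (so that `Γ` is infinite, Lemma `Ulemma`), for all
`h`-unitary `u₁, u₂` the real points of `u₁ u₂ u₁⁻¹ u₂⁻¹` lie in the REAL Zariski closure of the real points of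
`Γ` itself (`[γ z, γ' z'] = [γ, γ'] ∈ Γ`). `-- TODO(general form): the same for any root of unity λ ≠ ±1 with
Γ infinite (udensitytheo as printed); and SU(W,h) ⊆ Γ^Zar(ℝ), which needs [U,U] = SU for the algebraic groups.`

## References
* [CarlsonToledo1999] J. A. Carlson, D. Toledo, *Discriminant complements and kernels of monodromy
  representations*, Duke Math. J. 97 (1999), §7 Theorem `udensitytheo`, Lemma `Ulemma` (arXiv text p. 15).
* [Borel1991] A. Borel, *Linear Algebraic Groups*, 2nd ed., I.2.4 (commutator subgroups of closures).
-/

noncomputable section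

open Module

namespace Literature.AlgebraicGeometry.HodgeTheory

variable {W : Type} [AddCommGroup W] [Module ℂ W]

/-- Unit scalars commute with the real points of complex-linear automorphisms.
[cite: CarlsonToledo1999, §7 p. 15 L9–10] -/
theorem unitScalar_mul_restrictScalarsRealHom {z : W ≃ₗ[ℝ] W} (hz : z ∈ unitScalarSubgroup W)
    (g : W ≃ₗ[ℂ] W) : z * restrictScalarsRealHom W g = restrictScalarsRealHom W g * z := by
  obtain ⟨c, -, hc⟩ := (mem_unitScalarSubgroup_iff W z).1 hz
  ext x
  simp [LinearEquiv.mul_apply, hc]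

/-- Unit scalars commute with the real points of a subgroup of `GL_ℂ(W)`. [cite: CarlsonToledo1999, §7 p. 15 L9–10] -/
theorem unitScalar_mul_of_mem_map {Γ : Subgroup (W ≃ₗ[ℂ] W)} {z δ : W ≃ₗ[ℝ] W}
    (hz : z ∈ unitScalarSubgroup W) (hδ : δ ∈ Γ.map (restrictScalarsRealHom W)) : z * δ = δ * z := by
  obtain ⟨γ, -, rfl⟩ := Subgroup.mem_map.1 hδ
  exact unitScalar_mul_restrictScalarsRealHom hz γ

/-- Unit scalars commute with each other. [cite: CarlsonToledo1999, §7 p. 15 L9–10] -/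
theorem unitScalar_mul_comm {z z' : W ≃ₗ[ℝ] W} (hz : z ∈ unitScalarSubgroup W)
    (hz' : z' ∈ unitScalarSubgroup W) : z * z' = z' * z := by
  obtain ⟨c, -, hc⟩ := (mem_unitScalarSubgroup_iff W z).1 hz
  obtain ⟨c', -, hc'⟩ := (mem_unitScalarSubgroup_iff W z').1 hz'
  ext x
  simp [LinearEquiv.mul_apply, hc, hc', smul_smul, mul_comm c c']

/-- **`Γ·U(1) = {γ z}` elementwise**: every element of `realPointsWithUnitScalars W Γ` is a real point of
`Γ` times a unit scalar (the two generating subgroups commute). [cite: CarlsonToledo1999, §7 Theorem udensitytheo] -/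
theorem exists_eq_mul_of_mem_realPointsWithUnitScalars {Γ : Subgroup (W ≃ₗ[ℂ] W)} {x : W ≃ₗ[ℝ] W}
    (hx : x ∈ realPointsWithUnitScalars W Γ) :
    ∃ δ ∈ Γ.map (restrictScalarsRealHom W), ∃ z ∈ unitScalarSubgroup W, x = δ * z := by
  unfold realPointsWithUnitScalars at hx
  rw [Subgroup.sup_eq_closure] at hx
  induction hx using Subgroup.closure_induction with
  | mem y hy =>
    rcases hy with hy | hy
    · exact ⟨y, hy, 1, one_mem _, (mul_one y).symm⟩
    · exact ⟨1, one_mem _, y, hy, (one_mul y).symm⟩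
  | one => exact ⟨1, one_mem _, 1, one_mem _, (mul_one _).symm⟩
  | mul x y _ _ ihx ihy =>
    obtain ⟨δ, hδ, z, hz, rfl⟩ := ihx
    obtain ⟨δ', hδ', z', hz', rfl⟩ := ihy
    refine ⟨δ * δ', mul_mem hδ hδ', z * z', mul_mem hz hz', ?_⟩
    rw [mul_assoc δ z (δ' * z'), ← mul_assoc z δ' z', unitScalar_mul_of_mem_map hz hδ', mul_assoc, mul_assoc]
  | inv x _ ihx =>
    obtain ⟨δ, hδ, z, hz, rfl⟩ := ihx
    refine ⟨δ⁻¹, inv_mem hδ, z⁻¹, inv_mem hz, ?_⟩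
    rw [mul_inv_rev]
    exact unitScalar_mul_of_mem_map (inv_mem hz) (inv_mem hδ)

variable [FiniteDimensional ℂ W]

/-- **`[U(W,h), U(W,h)] ⊆ Γ^Zar(ℝ)` for a unitary `λ`-reflection group with `λ` of prime order `p ≥ 7`**
(Carlson–Toledo Theorem `udensitytheo` + Lemma `Ulemma`, with the central `U(1)` stripped by the commutator
argument of Borel I.2.4): under the hypotheses of `carlsonToledo1999_unitaryReflection_zariskiDense`
(`B` non-degenerate hermitian on `W`, `dim W ≥ 2`, `Δ` a `Γ`-stable `Γ`-transitive spanning set of vectors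
with `h(δ,δ) = ε = ±1`, `Γ` generated by the `λ`-reflections along `Δ`) and `λ^p = 1 ≠ λ`, `p ≥ 7` prime:
for all `h`-unitary `u₁, u₂`, the real points of the commutator `u₁ u₂ u₁⁻¹ u₂⁻¹` lie in the real Zariski
closure of the real points of `Γ` — no unit scalars. [cite: CarlsonToledo1999, §7 Theorem udensitytheo]
[cite: Borel1991, I.2.4] -/
theorem commutator_restrictScalars_mem_glZariskiClosure_of_prime_order
    (hCT : carlsonToledo1999_unitaryReflection_zariskiDense) {B : W →ₗ⋆[ℂ] W →ₗ[ℂ] ℂ}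
    (hB : B.IsSymm) (hBn : B.Nondegenerate) (hW : 2 ≤ finrank ℂ W) {ε : ℂ} (hε : ε = 1 ∨ ε = -1)
    {l : ℂ} {p : ℕ} (hp : p.Prime) (h7 : 7 ≤ p) (hlp : l ^ p = 1) (hl1 : l ≠ 1) {Δ : Set W}
    (hΔ : ∀ δ ∈ Δ, B δ δ = ε) (hspan : Submodule.span ℂ Δ = ⊤) {Γ : Subgroup (W ≃ₗ[ℂ] W)}
    (hΓ : Γ = Subgroup.closure {g : W ≃ₗ[ℂ] W | ∃ δ ∈ Δ, (g : W →ₗ[ℂ] W) = complexReflection B ε l δ})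
    (hstab : ∀ g ∈ Γ, ∀ δ ∈ Δ, g δ ∈ Δ) (htrans : ∀ δ ∈ Δ, ∀ δ' ∈ Δ, ∃ g ∈ Γ, g δ = δ')
    {u₁ u₂ : W ≃ₗ[ℂ] W} (hu₁ : ∀ x y, B (u₁ x) (u₁ y) = B x y) (hu₂ : ∀ x y, B (u₂ x) (u₂ y) = B x y) :
    restrictScalarsRealHom W (u₁ * u₂ * u₁⁻¹ * u₂⁻¹) ∈
      glZariskiClosure (Γ.map (restrictScalarsRealHom W)) := by
  have h₁ := hCT.mem_glZariskiClosure_of_prime_order hB hBn hW hε hp h7 hlp hl1 hΔ hspan hΓ hstab htrans hu₁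
  have h₂ := hCT.mem_glZariskiClosure_of_prime_order hB hBn hW hε hp h7 hlp hl1 hΔ hspan hΓ hstab htrans hu₂
  rw [map_mul, map_mul, map_mul, map_inv, map_inv]
  refine commutator_mem_glZariskiClosure (Δ₁ := realPointsWithUnitScalars W Γ)
    (Δ₂ := realPointsWithUnitScalars W Γ) (fun a ha c hc => ?_) h₁ h₂
  obtain ⟨δ, hδ, z, hz, rfl⟩ := exists_eq_mul_of_mem_realPointsWithUnitScalars ha
  obtain ⟨δ', hδ', z', hz', rfl⟩ := exists_eq_mul_of_mem_realPointsWithUnitScalars hc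
  -- `[δ z, δ' z'] = [δ, δ']`, the unit scalars commuting with everything in sight
  have hzδ' : z * δ' = δ' * z := unitScalar_mul_of_mem_map hz hδ'
  have hzz' : z * z' = z' * z := unitScalar_mul_comm hz hz'
  have hz'δ : z' * δ⁻¹ = δ⁻¹ * z' := unitScalar_mul_of_mem_map hz' (inv_mem hδ)
  have key : δ * z * (δ' * z') * (δ * z)⁻¹ * (δ' * z')⁻¹ = δ * δ' * δ⁻¹ * δ'⁻¹ := by
    simp only [mul_inv_rev, ← mul_assoc]
    rw [mul_assoc δ z δ', hzδ', ← mul_assoc, mul_assoc (δ * δ') z z', hzz', ← mul_assoc,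
      mul_assoc (δ * δ' * z') z z⁻¹, mul_inv_cancel, mul_one, mul_assoc (δ * δ') z' δ⁻¹, hz'δ, ← mul_assoc,
      mul_assoc (δ * δ' * δ⁻¹) z' z'⁻¹, mul_inv_cancel, mul_one]
  rw [key]
  exact mul_mem (mul_mem (mul_mem hδ hδ') (inv_mem hδ)) (inv_mem hδ')


/-! ### §2 (appended) The same on COMPLEX points: `[U(h), U(h)] ⊆ Γ^Zar(ℂ)` -/

/-- **`[U(W,h), U(W,h)] ⊆ Γ^Zar(ℂ)`** — the complex-points form of
`commutator_restrictScalars_mem_glZariskiClosure_of_prime_order`, through the restriction-of-scalars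
bridge `mem_glZariskiClosure_of_restrictScalarsRealHom` (`ZariskiClosureRealPoints`): under the hypotheses
of Carlson–Toledo's Theorem `udensitytheo` with `λ` of prime order `p ≥ 7`, the commutator of two
`h`-unitary automorphisms lies in the COMPLEX Zariski closure of the reflection group `Γ ≤ GL_ℂ(W)` itself —
the per-eigenspace input of the Goursat–Kolchin–Ribet step (`Katz1990_goursatKolchinRibet_specialLinear`,
hypothesis (1)) for the monodromy of the cyclic family. [cite: CarlsonToledo1999, §7 Theorem udensitytheo]
[cite: Borel1991, I.2.4] -/
theorem commutator_mem_glZariskiClosure_of_prime_order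
    (hCT : carlsonToledo1999_unitaryReflection_zariskiDense) {B : W →ₗ⋆[ℂ] W →ₗ[ℂ] ℂ}
    (hB : B.IsSymm) (hBn : B.Nondegenerate) (hW : 2 ≤ finrank ℂ W) {ε : ℂ} (hε : ε = 1 ∨ ε = -1)
    {l : ℂ} {p : ℕ} (hp : p.Prime) (h7 : 7 ≤ p) (hlp : l ^ p = 1) (hl1 : l ≠ 1) {Δ : Set W}
    (hΔ : ∀ δ ∈ Δ, B δ δ = ε) (hspan : Submodule.span ℂ Δ = ⊤) {Γ : Subgroup (W ≃ₗ[ℂ] W)}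
    (hΓ : Γ = Subgroup.closure {g : W ≃ₗ[ℂ] W | ∃ δ ∈ Δ, (g : W →ₗ[ℂ] W) = complexReflection B ε l δ})
    (hstab : ∀ g ∈ Γ, ∀ δ ∈ Δ, g δ ∈ Δ) (htrans : ∀ δ ∈ Δ, ∀ δ' ∈ Δ, ∃ g ∈ Γ, g δ = δ')
    {u₁ u₂ : W ≃ₗ[ℂ] W} (hu₁ : ∀ x y, B (u₁ x) (u₁ y) = B x y) (hu₂ : ∀ x y, B (u₂ x) (u₂ y) = B x y) :
    u₁ * u₂ * u₁⁻¹ * u₂⁻¹ ∈ glZariskiClosure Γ :=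
  mem_glZariskiClosure_of_restrictScalarsRealHom
    (commutator_restrictScalars_mem_glZariskiClosure_of_prime_order hCT hB hBn hW hε hp h7 hlp hl1 hΔ hspan hΓ
      hstab htrans hu₁ hu₂)

end Literature.AlgebraicGeometry.HodgeTheory

end
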